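import Literature.IUT.LogVolume.PacketDifferent
import Literature.IUT.LogVolume.TensorPacketLogHolds
import Literature.IUT.LogVolume.ArchimedeanTensorCopiesDecomposition
import Literature.IUT.LogVolume.ArchimedeanTensorCopiesInvariance
import HarnessLib

/-!
# [IUTchIV] §1 tensor-packet named facts — EXACT universal closures (the `DecidableEq` section instances discharged)

Mochizuki, *Inter-universal Teichmüller theory IV*, §1, Prop. 1.1 / Prop. 1.2 (ii)–(iv) / Prop. 1.5 (iii)
[cite: Mochizuki2012, IUTchIV Prop 1.1 p.9, Prop 1.2 p.10–11, Prop 1.5 p.14] (D-0012 claim key; these §1 statements are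
classical p-adic / archimedean facts and are PROVED in the tree).

PROOF-ONLY companion (abc-iut cell, D-0079 L-F, seat abc-iut-w4-d011 — C-R5a kernel-status companion).  The landed witnesses
`prop11_holds`, `prop12ii'_holds`, `prop12iii'_holds`, `prop12iv_holds` (abc-iut-S5/S6 lineages, `PacketDifferent.lean`,
`TensorPacketLogHolds.lean`) and `Prop15iii.prop15iii_decomposition_holds` / `prop15iii_metric_holds` / `prop15iii_preserved_holds`
(`ArchimedeanTensorCopies*.lean`) prove the FACT-LIST rows F-2252 / F-2254 / F-2256 / F-2257 / F-2225 / F-2226 / F-2227 under ONE extra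
section instance each — `[DecidableEq I]` (resp. `[DecidableEq I] [DecidableEq V]`) — that the named-fact `def`s themselves do not bind
(kernel type-audit 2026-08-26, `closure_of%` certification sweep: «has type … [DecidableEq I] … but is expected to have type …» with every
other binder identical).  Decidability instances are dischargeable classically, so the EXACT universal closures of the seven defs are
theorems: this file states each closure verbatim (binder list = the def's) and proves it by `classical exact …_holds`.  Nothing else is
assumed; no statement is restated under a new name (each theorem's type IS the def's closure).  F-2229 `Prop15iv` is NOT included: its
witness needs `[Fintype V]` while the def quantifies over every `V` — a genuine extra hypothesis, left as is.
-/

noncomputable section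

namespace Literature.IUT.LogVolume

/-- **F-2252 `Prop11` ([IUTchIV] Prop 1.1), exact universal closure** — `prop11_holds` with its `[DecidableEq I]` section instance
discharged classically. [cite: Mochizuki2012, IUTchIV Prop 1.1 p.9] -/
theorem prop11_closure : ∀ (p : ℕ) [Fact (Nat.Prime p)] {I : Type} [Fintype I] (k : I → Type)
    [∀ i, NontriviallyNormedField (k i)] [∀ i, NormedAlgebra ℚ_[p] (k i)] [∀ i, IsUltrametricDist (k i)]
    [∀ i, ProperSpace (k i)], Prop11 p k := by
  intro p _ I _ k _ _ _ _
  classical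
  exact prop11_holds p k

/-- **F-2254 `Prop12ii'` ([IUTchIV] Prop 1.2 (ii), primed twin), exact universal closure.** [cite: Mochizuki2012, IUTchIV Prop 1.2 (ii) p.10] -/
theorem prop12ii'_closure : ∀ (p : ℕ) [Fact (Nat.Prime p)] {I : Type} [Fintype I] (k : I → Type)
    [∀ i, NontriviallyNormedField (k i)] [∀ i, NormedAlgebra ℚ_[p] (k i)] [∀ i, IsUltrametricDist (k i)]
    [∀ i, ProperSpace (k i)], Prop12ii' p k := by
  intro p _ I _ k _ _ _ _
  classical
  exact prop12ii'_holds p k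

/-- **F-2256 `Prop12iii'` ([IUTchIV] Prop 1.2 (iii), primed twin), exact universal closure.** [cite: Mochizuki2012, IUTchIV Prop 1.2 (iii) p.11] -/
theorem prop12iii'_closure : ∀ (p : ℕ) [Fact (Nat.Prime p)] {I : Type} [Fintype I] (k : I → Type)
    [∀ i, NontriviallyNormedField (k i)] [∀ i, NormedAlgebra ℚ_[p] (k i)] [∀ i, IsUltrametricDist (k i)]
    [∀ i, ProperSpace (k i)], Prop12iii' p k := by
  intro p _ I _ k _ _ _ _
  classical
  exact prop12iii'_holds p k

/-- **F-2257 `Prop12iv` ([IUTchIV] Prop 1.2 (iv)), exact universal closure.** [cite: Mochizuki2012, IUTchIV Prop 1.2 (iv) p.11] -/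
theorem prop12iv_closure : ∀ (p : ℕ) [Fact (Nat.Prime p)] {I : Type} [Fintype I] (k : I → Type)
    [∀ i, NontriviallyNormedField (k i)] [∀ i, NormedAlgebra ℚ_[p] (k i)] [∀ i, IsUltrametricDist (k i)]
    [∀ i, ProperSpace (k i)], Prop12iv p k := by
  intro p _ I _ k _ _ _ _
  classical
  exact prop12iv_holds p k

namespace Prop15iii

/-- **F-2225 `Prop15iii_decomposition` ([IUTchIV] Prop 1.5 (iii), direct-sum decomposition), exact universal closure** —
`prop15iii_decomposition_holds` with `[DecidableEq I]` discharged classically. [cite: Mochizuki2012, IUTchIV Prop 1.5 (iii) p.14] -/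
theorem prop15iii_decomposition_closure :
    ∀ (I V : Type) [Fintype I] [Fintype V] [Nonempty I], Prop15iii_decomposition I V := by
  intro I V _ _ _
  classical
  exact prop15iii_decomposition_holds I V

/-- **F-2226 `Prop15iii_metric` ([IUTchIV] Prop 1.5 (iii), metric clause), exact universal closure.** [cite: Mochizuki2012, IUTchIV Prop 1.5 (iii) p.14] -/
theorem prop15iii_metric_closure : ∀ (I V : Type) [Fintype I] [Fintype V], Prop15iii_metric I V := by
  intro I V _ _
  classical
  exact prop15iii_metric_holds I V

/-- **F-2227 `Prop15iii_preserved` ([IUTchIV] Prop 1.5 (iii), preservation clause), exact universal closure** (`[DecidableEq I]`,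
`[DecidableEq V]` discharged classically). [cite: Mochizuki2012, IUTchIV Prop 1.5 (iii) p.14] -/
theorem prop15iii_preserved_closure : ∀ (I V : Type) [Fintype I] [Fintype V], Prop15iii_preserved I V := by
  intro I V _ _
  classical
  exact prop15iii_preserved_holds I V

end Prop15iii

end Literature.IUT.LogVolume

end
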